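import Mathlib
import Summits.Ventures.HodgeRepro2.Neat

/-!
# NeatTorsionFree — a neat subgroup is torsion-free (DR15 Lemma 1.1, first implication;
Tier 3 §7, B5 / N1 H11 «Γ_j acts freely»)

`Neat.lean` (p2 file 8) defines, for a number field `K` with a fixed embedding `τ : K → ℂ`, the
set `eigenvalueUnits K τ γ ⊂ ℂˣ` of the eigenvalues of `γ ∈ GL_m(K)` (the roots over `ℂ` of
the characteristic polynomial of `τ(γ)`), neatness of a set `Γ ⊆ GL_m(K)` (`IsNeat`: the
subgroup of `ℂˣ` generated by the eigenvalues of every `γ ∈ Γ` is torsion-free), torsion-freeness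
(`IsTorsionFreeSet`), and the Prop `NeatImpliesTorsionFree K τ : ∀ Γ, IsNeat K τ Γ →
IsTorsionFreeSet K Γ` — the first implication of DR15 Lemma 1.1, «left as a Prop» in the Tier-3
annex. This file proves it.

The argument, in kernel form: if `γ^n = 1` with `n > 0`, then `A := τ(γ)` satisfies `A^n = 1`;
every root `z` of `A.charpoly` is an eigenvalue (`exists_mulVec_eq_zero_iff` + `eval_charpoly`),
so `z^n = 1` (`eigenvalue_pow_eq_one_of_pow_eq_one`); neatness forces `z = 1`, so `A.charpoly =
(X − 1)^m` (`ℂ` algebraically closed: `card_roots_eq_natDegree`,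
`prod_multiset_X_sub_C_of_monic_of_roots_card_eq`), hence `(A − 1)^m = 0` by Cayley–Hamilton
(`aeval_self_charpoly`); finally a unipotent element of finite order in a `ℚ`-algebra is `1`
(`eq_one_of_pow_eq_one_of_isNilpotent_sub_one`: from `(N + 1)^n = 1` one gets
`(∑_{i<n} (N+1)^i) · N = 0` with the first factor a unit — `n·1` plus a nilpotent); so `A = 1`
and `γ = 1` (`τ` injective).

* `eq_one_of_pow_eq_one_of_isNilpotent_sub_one` — the `ℚ`-algebra lemma (any ring);
* `eigenvalue_pow_eq_one_of_pow_eq_one` — eigenvalues of a matrix of finite order are roots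
  of unity;
* `charpoly_eq_of_forall_mem_roots_eq_one` — all roots `1` ⇒ `charpoly = (X − 1)^m`;
* `sub_one_pow_eq_zero_of_forall_mem_roots_eq_one` — Cayley–Hamilton in that case;
* `eq_one_of_pow_eq_one_of_isNeat` — the matrix form;
* **`neatImpliesTorsionFree : NeatImpliesTorsionFree K τ`** — DR15 Lemma 1.1 (i) ⇒ (ii).
-/

namespace Summit.Ventures.HodgeRepro2.ShimuraData

open Polynomial Matrix

/-! ## §1 Unipotent elements of finite order are trivial (`ℚ`-algebras) -/

section Unipotent

variable {R : Type*} [Ring R] [Algebra ℚ R]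

/-- A non-zero natural number is a unit in a `ℚ`-algebra. -/
theorem isUnit_natCast_of_ne_zero {n : ℕ} (hn : n ≠ 0) : IsUnit (n : R) := by
  have : (n : R) = algebraMap ℚ R n := (map_natCast (algebraMap ℚ R) n).symm
  rw [this]
  exact (isUnit_iff_ne_zero.mpr (Nat.cast_ne_zero.mpr hn)).map (algebraMap ℚ R)

omit [Algebra ℚ R] in
/-- `(N + 1)^i − 1` is nilpotent when `N` is. -/
theorem isNilpotent_pow_sub_one {N : R} (hN : IsNilpotent N) (i : ℕ) :
    IsNilpotent ((N + 1) ^ i - 1) := by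
  have h := geom_sum_mul_add N i
  have : (N + 1) ^ i - 1 = (∑ j ∈ Finset.range i, (N + 1) ^ j) * N := by
    rw [← h]; abel
  rw [this]
  refine Commute.isNilpotent_mul_left ?_ hN
  exact Commute.sum_left _ _ _ fun j _ => ((Commute.refl N).add_left (Commute.one_left N)).pow_left j

omit [Algebra ℚ R] in
/-- Two polynomial expressions in `N` commute. -/
theorem commute_pow_sub_one (N : R) (i j : ℕ) :
    Commute ((N + 1) ^ i - 1) ((N + 1) ^ j - 1) := by
  have hc : Commute (N + 1) (N + 1) := Commute.refl _
  exact ((hc.pow_pow i j).sub_right (Commute.one_right _)).sub_left (Commute.one_left _)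

/-- The geometric sum `∑_{i<n} (N + 1)^i` is a unit when `N` is nilpotent and `n ≠ 0`. -/
theorem isUnit_geom_sum_of_isNilpotent {N : R} (hN : IsNilpotent N) {n : ℕ} (hn : n ≠ 0) :
    IsUnit (∑ i ∈ Finset.range n, (N + 1) ^ i) := by
  have hsplit : (∑ i ∈ Finset.range n, (N + 1) ^ i) =
      (n : R) + ∑ i ∈ Finset.range n, ((N + 1) ^ i - 1) := by
    rw [Finset.sum_sub_distrib, Finset.sum_const, Finset.card_range, nsmul_eq_mul, mul_one]
    abel
  rw [hsplit]
  refine IsNilpotent.isUnit_add_left_of_commute ?_ (isUnit_natCast_of_ne_zero hn) ?_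
  · exact Commute.isNilpotent_sum (fun i _ => isNilpotent_pow_sub_one hN i)
      (fun i j _ _ => commute_pow_sub_one N i j)
  · exact Commute.sum_left _ _ _ fun i _ => (Nat.cast_commute n _).symm

/-- **A unipotent element of finite order is trivial.** In a `ℚ`-algebra, if `x − 1` is
nilpotent and `x^n = 1` for some `n > 0`, then `x = 1`. -/
theorem eq_one_of_pow_eq_one_of_isNilpotent_sub_one {x : R} (hx : IsNilpotent (x - 1))
    {n : ℕ} (hn : 0 < n) (h : x ^ n = 1) : x = 1 := by
  have hx' : x = (x - 1) + 1 := by abel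
  have hpow : ((x - 1) + 1) ^ n = 1 := by rw [← hx']; exact h
  have hgeom := geom_sum_mul_add (x - 1) n
  rw [hpow] at hgeom
  have hzero : (∑ i ∈ Finset.range n, ((x - 1) + 1) ^ i) * (x - 1) = 0 := by
    have := congrArg (fun t => t - 1) hgeom
    simpa using this
  have hunit := isUnit_geom_sum_of_isNilpotent hx (Nat.pos_iff_ne_zero.mp hn)
  have hN0 : x - 1 = 0 := (hunit.mul_right_eq_zero).mp hzero
  exact sub_eq_zero.mp hN0

end Unipotent

/-! ## §2 Eigenvalues of a matrix of finite order -/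

section Matrix

variable {m : ℕ}

/-- A root of the characteristic polynomial is an eigenvalue: there is a non-zero vector `v`
with `A *ᵥ v = z • v`. -/
theorem exists_mulVec_eq_smul_of_mem_roots (A : Matrix (Fin m) (Fin m) ℂ) {z : ℂ}
    (hz : z ∈ A.charpoly.roots) : ∃ v : Fin m → ℂ, v ≠ 0 ∧ A *ᵥ v = z • v := by
  have hroot : A.charpoly.eval z = 0 := (mem_roots'.mp hz).2
  rw [eval_charpoly] at hroot
  obtain ⟨v, hv, hAv⟩ := (exists_mulVec_eq_zero_iff).mpr hroot
  refine ⟨v, hv, ?_⟩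
  rw [sub_mulVec, sub_eq_zero] at hAv
  rw [← hAv, scalar_apply]
  ext i
  rw [mulVec_diagonal, Pi.smul_apply, smul_eq_mul]

/-- `A^k *ᵥ v = z^k • v` for an eigenvector. -/
theorem pow_mulVec_eq_pow_smul (A : Matrix (Fin m) (Fin m) ℂ) {z : ℂ} {v : Fin m → ℂ}
    (hv : A *ᵥ v = z • v) (k : ℕ) : A ^ k *ᵥ v = z ^ k • v := by
  induction k with
  | zero => simp
  | succ k ih =>
    rw [pow_succ, ← mulVec_mulVec, hv, mulVec_smul, ih, smul_smul, pow_succ, mul_comm]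

/-- **Eigenvalues of a matrix of finite order are roots of unity.** -/
theorem eigenvalue_pow_eq_one_of_pow_eq_one (A : Matrix (Fin m) (Fin m) ℂ) {n : ℕ}
    (hA : A ^ n = 1) {z : ℂ} (hz : z ∈ A.charpoly.roots) : z ^ n = 1 := by
  obtain ⟨v, hv, hAv⟩ := exists_mulVec_eq_smul_of_mem_roots A hz
  have h := pow_mulVec_eq_pow_smul A hAv n
  rw [hA, one_mulVec] at h
  have : (z ^ n - 1) • v = 0 := by rw [sub_smul, one_smul, ← h, sub_self]
  rcases smul_eq_zero.mp this with h1 | h1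
  · exact sub_eq_zero.mp h1
  · exact absurd h1 hv

/-- If every root of the characteristic polynomial is `1`, then `charpoly = (X − 1)^m`. -/
theorem charpoly_eq_of_forall_mem_roots_eq_one (A : Matrix (Fin m) (Fin m) ℂ)
    (h : ∀ z ∈ A.charpoly.roots, z = 1) : A.charpoly = (X - C (1 : ℂ)) ^ m := by
  have hcard : Multiset.card A.charpoly.roots = A.charpoly.natDegree :=
    IsAlgClosed.card_roots_eq_natDegree
  have hprod := prod_multiset_X_sub_C_of_monic_of_roots_card_eq (charpoly_monic A) hcard
  have hroots : A.charpoly.roots = Multiset.replicate m 1 := by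
    rw [Multiset.eq_replicate]
    refine ⟨?_, h⟩
    rw [hcard, charpoly_natDegree_eq_dim, Fintype.card_fin]
  rw [← hprod, hroots, Multiset.map_replicate, Multiset.prod_replicate]

/-- Cayley–Hamilton when all eigenvalues are `1`: `(A − 1)^m = 0`. -/
theorem sub_one_pow_eq_zero_of_forall_mem_roots_eq_one (A : Matrix (Fin m) (Fin m) ℂ)
    (h : ∀ z ∈ A.charpoly.roots, z = 1) : (A - 1) ^ m = 0 := by
  have hCH := aeval_self_charpoly A
  rw [charpoly_eq_of_forall_mem_roots_eq_one A h, map_pow, map_sub, aeval_X, aeval_C,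
    Algebra.algebraMap_eq_smul_one, one_smul] at hCH
  exact hCH

/-- A complex matrix of finite order all of whose eigenvalues are `1` is the identity. -/
theorem eq_one_of_pow_eq_one_of_forall_mem_roots_eq_one (A : Matrix (Fin m) (Fin m) ℂ)
    {n : ℕ} (hn : 0 < n) (hA : A ^ n = 1) (h : ∀ z ∈ A.charpoly.roots, z = 1) : A = 1 :=
  eq_one_of_pow_eq_one_of_isNilpotent_sub_one
    ⟨m, sub_one_pow_eq_zero_of_forall_mem_roots_eq_one A h⟩ hn hA

end Matrix

/-! ## §3 Neat ⇒ torsion-free -/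

section Neat

variable {K : Type*} [Field K] {m : ℕ}

/-- `τ(γ^n) = τ(γ)^n`. -/
theorem map_val_pow (τ : K →+* ℂ) (γ : GL (Fin m) K) (n : ℕ) :
    ((γ ^ n : GL (Fin m) K) : Matrix (Fin m) (Fin m) K).map τ =
      ((γ : Matrix (Fin m) (Fin m) K).map τ) ^ n := by
  rw [Units.val_pow_eq_pow_val]
  exact map_pow (RingHom.mapMatrix τ) _ n

/-- For a neat element of finite order, every eigenvalue is `1`. -/
theorem eigenvalue_eq_one_of_isNeat (τ : K →+* ℂ) {Γ : Set (GL (Fin m) K)}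
    (hΓ : IsNeat K τ Γ) {γ : GL (Fin m) K} (hγ : γ ∈ Γ) {n : ℕ} (hn : 0 < n)
    (hpow : γ ^ n = 1) {z : ℂ}
    (hz : z ∈ ((γ : Matrix (Fin m) (Fin m) K).map τ).charpoly.roots) : z = 1 := by
  have hA : ((γ : Matrix (Fin m) (Fin m) K).map τ) ^ n = 1 := by
    rw [← map_val_pow, hpow, Units.val_one, Matrix.map_one τ (map_zero τ) (map_one τ)]
  have hzn : z ^ n = 1 := eigenvalue_pow_eq_one_of_pow_eq_one _ hA hz
  have hz0 : z ≠ 0 := by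
    intro h0
    rw [h0, zero_pow (Nat.pos_iff_ne_zero.mp hn)] at hzn
    exact zero_ne_one hzn
  have hmem : Units.mk0 z hz0 ∈ Subgroup.closure (eigenvalueUnits K τ γ) :=
    Subgroup.subset_closure (by simpa [eigenvalueUnits] using hz)
  have hunit : Units.mk0 z hz0 = 1 := by
    refine hΓ γ hγ _ hmem n hn ?_
    ext
    simp [hzn]
  have := congrArg Units.val hunit
  simpa using this

/-- A neat element of finite order is trivial. -/
theorem eq_one_of_pow_eq_one_of_isNeat (τ : K →+* ℂ) {Γ : Set (GL (Fin m) K)}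
    (hΓ : IsNeat K τ Γ) {γ : GL (Fin m) K} (hγ : γ ∈ Γ) {n : ℕ} (hn : 0 < n)
    (hpow : γ ^ n = 1) : γ = 1 := by
  have hA : ((γ : Matrix (Fin m) (Fin m) K).map τ) ^ n = 1 := by
    rw [← map_val_pow, hpow, Units.val_one, Matrix.map_one τ (map_zero τ) (map_one τ)]
  have hmap : (γ : Matrix (Fin m) (Fin m) K).map τ = 1 :=
    eq_one_of_pow_eq_one_of_forall_mem_roots_eq_one _ hn hA
      (fun z hz => eigenvalue_eq_one_of_isNeat τ hΓ hγ hn hpow hz)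
  have hinj : Function.Injective (fun M : Matrix (Fin m) (Fin m) K => M.map τ) :=
    Matrix.map_injective τ.injective
  apply Units.ext
  apply hinj
  simp only
  rw [hmap, Units.val_one, Matrix.map_one τ (map_zero τ) (map_one τ)]

/-- **DR15 Lemma 1.1, first implication: a neat set is torsion-free.** -/
theorem neatImpliesTorsionFree (τ : K →+* ℂ) : NeatImpliesTorsionFree K τ (m := m) :=
  fun _ hΓ _ hγ _ hn hpow => eq_one_of_pow_eq_one_of_isNeat τ hΓ hγ hn hpow

end Neat

end Summit.Ventures.HodgeRepro2.ShimuraData
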